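import Summits.QuantumFields.YangMills.Theorems.BalabanUVNodesN19KeyedCoreEdgeHolderD4LedgerK3V5
import Summits.QuantumFields.YangMills.Theorems.BalabanUVNodesN19UniformLettersAtU3Pin
import Summits.QuantumFields.YangMills.Theorems.BalabanUVNodesN19BundleDecayLetterFromStub1Rows

/-!
# BalabanUVNodes ∕ N19 — K3⁷ v5's N19′ CONJUNCT AT THE LEDGER READING BY THE TWO-COMPONENT (COVARIANCE) ROAD: dag-n19-w3 g3's (8b) ★★★ BY NAME with its two node-U3
# hypotheses `hunif` and `hdecT` DISCHARGED from stub 1's bill rows `hs ∕ hL ∕ h9 ∕ hW` (the bill's own (0,1) letter), the `(0, 0)` sibling `hW00` and Euclidean covariance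
# `hcov` of the record's limiting kernels ([I] (1.21) p. 264 ∕ (5.6) p. 292) — the `_cov` companion of dag-n19-w3's ∀μν-road file `…N19KeyedCoreEdgeHolderD4LettersK3V5` (p618248)

Cell `pub-ymgap`, HUMAN RULING D-0062 (Track A) ∕ D-0149 ∕ D-0154 (director-ym R399 (3a), №207 width wave), width seat `pub-ymgap-dag-n19-w5`
(harness re-seat g1 of generation 0), FILE 7 — a COROLLARY by name of dag-n19-w3 g3's (8b) `BalabanUVNodesN19KeyedCoreEdgeHolderD4LedgerK3V5` (p614196 ✓).  SPLIT OF RECORD (INBOX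
I.32026, dag-lead DEDUP): the ∀μν road (rows `hs hL h9` + W1's windowed (5.10) letter at all sixteen pairs `hWall`) is dag-n19-w3's INTENT-9 = `…N19KeyedCoreEdgeHolderD4LettersK3V5`
(p618248; first claim 08:25Z); the `_cov` road below was left to this seat («NOT MINE — yours if you want it»).  THEOREMS ONLY (0 `def`, 0 `instance`, 0 `sorry`); imports (8b) +
this seat's FILE 5 `…N19UniformLettersAtU3Pin` (p615362) + FILE 6 `…N19BundleDecayLetterFromStub1Rows` (p616024) ONLY; modifies nothing; nothing of (8b) is restated — its three
theorems are APPLIED with `hunif := hunif_of_u3Pinned_of_signs …` and `hdecT := hdecT_of_u3Pinned_of_stub1Rows_cov …`, the pin being the `U3PinnedKernels` conjunct of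
`GuardedReadingN16` itself (`hG16.1.2.2.2`).  `--kind proof --supports` K3⁷ `SpineGivenEndpointR13SepCoPH` (stmt-QuantumFields-20544) `--as helper` — COUNT-NEUTRAL.  As (8b), this
file sits downstream of `…K3V5Defs` (hence the route's Theses module): the `lint.theses-cone` ADVISORY is expected, exactly as for p608258 ∕ p614196 ∕ p618248.

WHAT.  ★★ `keyedCoreEdgeHolderD4_rrOfRecord_of_guardedReadingN16_ledgerLinkReading_stub1Rows_cov` : `K3V5Defs.KeyedCoreEdgeHolderD4 β cr (K3V5Defs.rrOfRecord 𝔯 ksel)` from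
`GuardedReadingN16 𝔯 ksel ℓ ℓ₃ g B`, `β ≤ 1`, K1⁷'s window `hβw`, NODE O's ledger world `hlinkLedger` (VERBATIM (8a)∕(8b) binder), STUB 1's BILL ROWS `hs ∕ hL ∕ h9 ∕ hW` (dag-n27-w1
`K3V5Defs.keyedRatesHolderD4_rrOfRecord_of_pins_of_letters`, SAME texts — `hW` is the bill's windowed (5.10) letter at the pair `(0, 1)`), the ONE extra component `hW00` (pair `(0, 0)`)
and the covariance row `hcov` (`B12Beta.PermCovariant` of every limiting kernel `kernelA … g k` of the record, `g` in the record window, at every guarded admissible tuple); ★★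
`hybridNE7Under_…_stub1Rows_cov` and ★★ `spineGivenEndpointR13SepCoPH_…_stub1Rows_cov`: (8b)'s second and third theorems likewise (`HybridNE7Under` per guarded admissible tuple; the
crux's statement CONDITIONALLY, with stub 1's rates conjunct `hr` and stub 2's other faces `h20 h21 hx`).

LOCATED (count-neutral; for the plan's v6 precut and dag-n27's item-level composites).  The two roads side by side: at v5's FULL key the N19′ face of `stub_expansion13H` costs NODE O's
ledger world `hlinkLedger` + K1⁷'s rung-2 window + `β ≤ 1` + stub 1's U3 letter rows, plus EITHER W1's windowed (5.10) letter at the 15 remaining direction pairs (p618248) OR its `(0, 0)`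
component and Euclidean covariance of the limiting kernels (this file) — a coordinate permutation reaches every off-diagonal pair from `(0, 1)` and every diagonal pair from `(0, 0)`, never a
diagonal from an off-diagonal (FILE 4).  Every row is a DISPLAYED HYPOTHESIS inhabited for no family today.

HONEST FRAMING.  Three applications of landed theorems; ZERO estimate content; nothing of Bałaban's asserted; `hlinkLedger` (NODE O's world) 0∕1 inhabited; NE7 NOT PRINTED ∕ NOT proved;
NOT `stub_expansion13H` (its `PinnedAtLive` face and the ∃ over `jc sh cr` untouched), NOT K3⁷ (the third theorem is the crux decl UNDER DISPLAYED HYPOTHESES — `proof.conditional`, credits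
nothing); N14 ∕ N16 ∕ N19 ∕ N22 NOT discharged; K3⁷ OPEN, unclaimed, skeleton v5 UNTOUCHED; counts UNMOVED (typed 28∕28 · discharged 5∕27 · A 5∕28).  One finite 𝕋⁴ at fixed ε — R4 closes
the CONDITIONAL rung `BalabanLadder.UV` only; the Yang–Mills mass gap (Clay) is NOT proved by any of this.  [bookkeeping] throughout.  [I] = [Balaban1987RG1].
-/

noncomputable section

open scoped BigOperators Matrix Matrix.Norms.L2Operator

namespace Summit.QuantumFields.YangMills.BalabanUVNodes.N19KeyedCoreEdgeHolderD4LedgerK3V5Stub1Rows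

open Literature.MathematicalPhysics.QuantumFieldTheory.Balaban1983to89
open T4OutputRate T4RecentScale T4GoodClassBudget T4CauchySum T4TowerRateComposition T4TowerRateDischarge
open T4EtaRateMin (Readings NE3Shape)
open T4RateLiaison (GaugeDominated)
open FlowStep (RGEqH prefixOf)
open TreeLengthTorus (TFaceConnected torusTreeLen)
open B12TreeDecay (kappa₀)
open Summit.QuantumFields.BalabanUV.T4Continuum
open AveragingDeficitDualResidual (dualC1 dualC2)
open AveragingDeficitDerivWallProof (wallConst)
open AveragingDeficitPeriodicCounting (IsPeriodicDir)
open MinimalActionSandwich (IsMinimiser minAct)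
open MinimalActionRate (sfClass)
open MinimalActionRefine (RegularSup gradConst)
open NE3EnergyShapes (IsUnitarySite IsPeriodicSite)
open NE3.LeafIndexSockets (LeafH3sup)
open Summit.QuantumFields.BalabanUV.T4Continuum.Spine
open Summit.QuantumFields.BalabanUV.T4Continuum.Spine.NE4 (runFlow)
open Summit.QuantumFields.BalabanUV.T4Continuum.NE1p.DressedRoot (DressedTower DressedStabilityStrict)
open Summit.QuantumFields.YangMills.BalabanUVNodes.N19LedgerLinkSync (LedgerDataSync LedgerAtSync)
open YMDAG.UVSplit (SpineCarriers SpineRecordPred InputsPred U3Carriers RateCarriers RateRecordPred N14At N18At N22At ReadOutAt)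
open Summit.QuantumFields.YangMills.BalabanUVNodes.N16HolderDefs (CovRootHolder N16HolderAt)
open Summit.QuantumFields.YangMills.BalabanUVNodes.SpineRatesHolder (RatesHolderAt)
open Literature.MathematicalPhysics.QuantumFieldTheory.Balaban1983to89.T4Continuum (T4Family ULoop)
open YMDAG.UVSplit (Datum RateReading₁₃CoPH rateCarriersOfRecord₁₃CoPH ne3OfRecord₁₁)
open Node00 (Stage13HParams datumOfRecord₁₃CoPH SiteSeqKey NE3Letters₁₁ ne3ConstLayerOfRecord₁₁ ne3NperOfRecord₁₁ ne3DomOfRecord₁₁)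
open Summit.QuantumFields.YangMills.BalabanUVNodes.N16PinnedLayer13CoPH (N16PinnedLoose N16LettersEnd)
open YMDAG.N14.TopBorn (ne1OfRecord obsSupNorm)
open YMDAG.N14.TopBorn (obsSupNorm_nonneg)
open Node00 (U3Letters₁₁)
open Literature.MathematicalPhysics.QuantumFieldTheory.Balaban1983to89.Node00.U3OfKernels (objectsOfRecord₁₃)
open T4WeightBudget (RelWeightBound)
open T4IndicatorShell (ShellWeightBound)
open T4ContinuumYM4Torus (ForSmallCouplings)
open T4ApexHybrid (HybridNE7Under)
open Summit.QuantumFields.YangMills.BalabanUVNodes.N19CoreEdgeFSCComposer (keyedGuarded₁₃CoPH_of_keyedFacesP_fsc)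
open Summit.QuantumFields.YangMills.BalabanUVNodes.N19RateEdgeHolderD4AtN16PinnedReadingFSC (keyedCoreEdgeHolderD4_of_linkReadingAtN16PinnedReading)
open Summit.QuantumFields.YangMills.BalabanUVNodes.N19RateEdgeHolderD4AtPinnedReading (linkReadingAtN16PinnedReading_of_linkReadingAtPinnedReading)
open Summit.QuantumFields.YangMills.BalabanUVNodes.N19RateEdgeHolderD4AtKeyedReading (linkReadingAtPinnedReading_of_linkReadingAtKeyedReading)
open Summit.QuantumFields.YangMills.BalabanUVNodes.N19RateEdgeHolderD4AtLedgerReading (linkReadingAtKeyedReading_of_linkReadingAtLedgerReading)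
open Summit.QuantumFields.YangMills.Theorems.K3V5Defs (SpineReading RunSel LetterReading rrOfRecord PHolderD4 KeyedRatesHolderD4 GuardedReadingN16 KeyedRelWeight KeyedShellWeight
  KeyedCoreEdgeHolderD4 KeyedExtraction)
open Literature.MathematicalPhysics.QuantumFieldTheory.Balaban1983to89.Node00 (mergedTermFamilyMatT TβOfRecord₁₃ chiβOfRecord₁₃)
open Literature.MathematicalPhysics.QuantumFieldTheory.Balaban1983to89.Node00.U3OfKernels (kernelA)
open Literature.MathematicalPhysics.QuantumFieldTheory.Balaban1983to89.Node00.U3KernelLetters (PolLimitsExistOfRecord₁₃ WindowedNE9OfRecord₁₃ WindowedDecayOfRecord₁₃)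
open Literature.MathematicalPhysics.QuantumFieldTheory.Balaban1983to89.B12Beta (PermCovariant)
open Summit.QuantumFields.YangMills.BalabanUVNodes.N19KeyedCoreEdgeHolderD4LedgerK3V5 (keyedCoreEdgeHolderD4_rrOfRecord_of_guardedReadingN16_ledgerLinkReading
  hybridNE7Under_of_guardedReadingN16_keyedFaces_ledgerLinkReading spineGivenEndpointR13SepCoPH_of_guardedReadingN16_keyedFaces_ledgerLinkReading)
open Summit.QuantumFields.YangMills.BalabanUVNodes.N19UniformLettersAtU3Pin (hunif_of_u3Pinned_of_signs)
open Summit.QuantumFields.YangMills.BalabanUVNodes.N19BundleDecayLetterFromStub1Rows (hdecT_of_u3Pinned_of_stub1Rows_cov)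

section ByName

variable (cr : SpineReading) (𝔯 : RateReading₁₃CoPH 2) (ksel : RunSel) (ℓ : LetterReading) (ℓ₃ : T4Family → NE3Letters₁₁) (g B : T4Family → ℝ) {β : ℝ} (hβ1 : β ≤ 1)
  (hG16 : GuardedReadingN16 𝔯 ksel ℓ ℓ₃ g B)
    (hβw : ∀ (F : T4Family) (θ : Stage13HParams F 2) (hP : θ.Provisos₁₃CoPH F 2), (θ.ZhUnity F 2 ∧ θ.SlotsNondegenerate₁₃ F 2) → θ.Admissible F 2 →
      ∃ γ₀ b b' : ℝ, 0 < γ₀ ∧ 0 < b ∧ DagBinding.BetaBoundsInInterval (datumOfRecord₁₃CoPH F 2 θ hP).C.toB12 γ₀ b b')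
  (hlinkLedger : ∀ (F : T4Family) (θ : Stage13HParams F 2) (hP : θ.Provisos₁₃CoPH F 2), (θ.ZhUnity F 2 ∧ θ.SlotsNondegenerate₁₃ F 2) → θ.Admissible F 2 →
    ∀ (γ gIR b : ℝ) (g₀ : ℕ → ℝ), (datumOfRecord₁₃CoPH F 2 θ hP).Tuned γ gIR g₀ → γ ≤ θ.γ → γ ^ 2 ≤ Real.exp (-1) → 0 < b →
    (∀ K m, 0 ≤ m → m < K → b ≤ (datumOfRecord₁₃CoPH F 2 θ hP).βfun m (prefixOf (runFlow (datumOfRecord₁₃CoPH F 2 θ hP) g₀ K) m)) →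
    ∀ (os : List (ULoop F)) (k : ℕ),
      let S : SpineCarriers := cr F θ hP g₀ os
      let R : RateCarriers 2 := rateCarriersOfRecord₁₃CoPH 𝔯 F θ hP g₀ os k
      let D : Datum F 2 := datumOfRecord₁₃CoPH F 2 θ hP
      letI := S.dec
      ∃ (_ : DecidableEq R.u3.C.Dom) (F' : Type) (ι' X' : Type) (_ : MeasurableSpace ι')
        (L : LedgerDataSync R.u3.C F' ι' S.ι) (Rd : Readings ι' X') (bsel : (ℕ → ℝ) → ℝ) (EB : Functional R.u3.C R.u3.C.BgB)
        (θc θ₃ : ℝ) (g : ℕ → ℕ → ℝ)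
        (uA : ℕ → ι' → R.u3.C.BgA) (uB : ℕ → ι' → R.u3.C.BgB)
        (Pf : ℕ → Params) (d₀ L₀ Koff : ℕ) (cells : (K j : ℕ) → R.u3.C.Dom → Finset (Site (Pf K) j))
        (H033 : Flow → ℕ → Prop) (I : Type) (fam : I → B14.Sect2Data) (Lb βw : ℝ) (κ₁ : ℕ) (Gv Cl : ℝ) (K₁ : ℕ)
        (dressed : R.u3.C.Dom → Prop) (_ : DecidablePred dressed)
        (c' t θ γ₃ l₁ : ℝ)
        (sel : ℕ → (B7Prop1Explicit.Site 4 → Fin 4 → (Matrix (Fin 2) (Fin 2) ℂ)ˣ) → (B7Prop1Explicit.Site 4 → Fin 4 → (Matrix (Fin 2) (Fin 2) ℂ)ˣ))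
        (rd : ι' → (B7Prop1Explicit.Site 4 → Fin 4 → (Matrix (Fin 2) (Fin 2) ℂ)ˣ)),
        (∀ K i, i ≤ K → g K i = runFlow D g₀ K i) ∧ (∀ K i, K < i → g K i = gIR) ∧
        EB = (fun s => R.u3.EB (bsel s) s) ∧
        (∀ (Sz : ℕ → ℝ → S.ι → ℕ → ℝ) (E₀ : ℝ) (m : ℕ) (a : ℝ) (Cw Λg : ℝ),
          (∀ K t, |t| ≤ S.l₀ → ∀ τ ∈ S.T K \ S.Bad K t, ∀ v ∈ Rd.dom, ∀ j ≤ K,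
            |∑ X ∈ L.fac K t τ with R.u3.C.scale X = j,
                (Real.log (Real.exp (EB (fun i => g (K + 1) (i + 1)) (uB K v) X
                    - EB (fun i => g (K + 1) (i + 1)) L.oneB X))
                  - Real.log (Real.exp (R.u3.EA (g K) (uA K v) X - R.u3.EA (g K) L.oneA X)))| ≤ Sz K t τ j) →
          0 ≤ E₀ → 0 < a → a < 1 →
          (∀ K t, |t| ≤ S.l₀ → ∀ τ ∈ S.T K \ S.Bad K t, ∀ j ≤ K,
            Sz K t τ j ≤ S.vol * (E₀ * ((K : ℝ) + 1) ^ m * a ^ (K - j))) →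
          (∀ K, Multiplicity (L.All K) R.u3.C.scale (fun X => Real.exp (-(R.u3.κ * R.u3.C.d X))) Cw S.vol Λg K) →
          (∀ K t, |t| ≤ S.l₀ → ∀ τ ∈ S.T K \ S.Bad K t,
            WindowMultiplicity (L.facO K t τ) L.scO L.wO Cw S.vol Λg (jlogOf L.Cl K) K) →
          1 ≤ Λg → L.θ' ≤ Λg →
          LedgerAtSync { L with S := Sz, E₀ := E₀, m := m, a := a, Cw := Cw, Λg := Λg } S.l₀ S.vol S.T S.Bad
            (fun K t τ => S.A K t τ - S.shA K t τ) (fun K t τ => S.B K t τ - S.shB K t τ) Rd R.u3.EA EB R.u3.κ g uA uB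
            R.u3.ω θc R.u3.θ θ₃) ∧
        0 ≤ S.vol ∧
        (∀ K t, |t| ≤ S.l₀ → ∀ τ ∈ S.T K \ S.Bad K t,
          WindowMultiplicity (L.facO K t τ) L.scO L.wO L.Cw S.vol L.Λg (jlogOf L.Cl K) K) ∧
        0 ≤ L.Cw ∧ 1 ≤ L.Λg ∧ L.θ' ≤ L.Λg ∧
        (∀ K, (Pf K).d = d₀) ∧ (∀ K, (Pf K).L = L₀) ∧ (∀ K, (Pf K).K = Koff + K) ∧
        (∀ K, (Fintype.card (Site (Pf K) (Pf K).K) : ℝ) = S.vol) ∧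
        kappa₀ (4 * 2 ^ d₀) (2 * d₀) ≤ R.u3.κ ∧
        (∀ K, ∀ X ∈ L.All K,
          (cells K (R.u3.C.scale X + Koff) X).Nonempty ∧ TFaceConnected (cells K (R.u3.C.scale X + Koff) X)) ∧
        (∀ K j, Set.InjOn (cells K j) ↑((L.All K).filter fun X => R.u3.C.scale X + Koff = j)) ∧
        (∀ K, ∀ X ∈ L.All K, torusTreeLen (cells K (R.u3.C.scale X + Koff) X) ≤ R.u3.C.d X) ∧
        B14.Thm2Printed H033 fam Lb βw κ₁ ∧ βw < 1 ∧ 0 < βw ∧ 1 < Lb ∧ 1 ≤ Gv ∧ 0 ≤ Cl ∧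
        (∀ K t, |t| ≤ S.l₀ → ∀ τ ∈ S.T K \ S.Bad K t, ∀ j ≤ K, ∃ (i : I) (w : (fam i).Ω) (j' : ℕ),
          (fam i).flow.SatisfiesRG (fam i).K ∧ H033 (fam i).flow (fam i).K ∧ 1 ≤ j' ∧ j' ≤ (fam i).K ∧
          (fam i).K - j' = K - j ∧ (fam i).K ≤ K + K₁ ∧
          (∀ n, 0 ≤ (fam i).gammaVol n w) ∧ (fam i).gammaVol (fam i).K w ≤ S.vol ∧
          (∀ n, n < (fam i).K → n < jlogOf Cl (fam i).K → (fam i).gammaVol n w = 0) ∧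
          (∀ n, n < (fam i).K → jlogOf Cl (fam i).K ≤ n → (fam i).gammaVol n w ≤ S.vol * Gv ^ ((fam i).K - n))) ∧
        (∀ K t, |t| ≤ S.l₀ → ∀ τ ∈ S.T K \ S.Bad K t,
          (∀ X ∈ (L.fac K t τ).filter (fun X => dressed X), R.u3.C.scale X = K) ∧
          ((L.fac K t τ).filter (fun X => dressed X)).card ≤ 1 ∧
          ((((L.fac K t τ).filter (fun X => dressed X)).card : ℝ) ≤ S.vol)) ∧
        R.ne3.g = gradConst 4 c' ∧ 0 ≤ c' ∧ R.ne3.b ≤ t ∧ c' ≤ t ∧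
        (2 : ℝ) ^ 91 * (R.ne3.L : ℝ) ^ 17 * t ≤ 1 ∧ (2 : ℝ) ^ 76 * (R.ne3.L : ℝ) ^ 12 * t ≤ R.ne3.ε ∧
        16 * B7Prop2Explicit.C0 4 * R.ne3.ε ≤ 3 ∧ 1024 * (4 + 1) * (4 + 4) * (R.ne3.L : ℝ) ^ 2 * R.ne3.ε ≤ 1 ∧
        4 * ((ℓ₃ F).ε / B F) ≤ c' ∧
        LeafH3sup 4 R.ne3.L R.ne3.Nper R.ne3.ε R.ne3.b c' R.ne3.dom ∧
        (∀ V ∈ R.ne3.dom, ∀ k : ℕ, IsMinimiser 4 (sfClass 4 R.ne3.L R.ne3.Nper R.ne3.ε) R.ne3.L R.ne3.Nper k V (sel k V)) ∧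
        (∀ V ∈ R.ne3.dom, ∀ k : ℕ, RegularSup 4 R.ne3.L R.ne3.Nper R.ne3.b c' k (sel k V)) ∧
        0 < θ ∧ θ ^ 6 = ((R.ne3.L : ℝ))⁻¹ ∧ 0 < γ₃ ∧
        R.ne3.C * (wallConst 4 R.ne3.L * (R.ne3.Nper : ℝ) ^ 2 *
          (Real.sqrt (gradConst 4 c') * dualC2 4 R.ne3.L + 2 * R.ne3.b ^ 2 * dualC1 4 R.ne3.L)) ≤ γ₃ ^ 3 ∧
        0 < l₁ ∧ R.ne3.Λ₁ ≤ l₁ ^ 3 ∧ γ₃ * θ ^ 2 ≤ l₁ * R.ne3.Nper ∧ θ ^ ((3 : ℝ) * β - 2) ≤ θ₃ ∧ θ₃ < 1 ∧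
        (∀ v ∈ Rd.dom, rd v ∈ R.ne3.dom) ∧
        (∀ k, ∀ v ∈ Rd.dom, Rd.act k v = minAct 4 (sfClass 4 R.ne3.L R.ne3.Nper R.ne3.ε) R.ne3.L R.ne3.Nper k (rd v)) ∧
        (R.ne3.Nper : ℝ) ^ 4 ≤ Rd.vol ∧
        R.u3.ρ ≤ θc ∧
        (∀ s ∈ Window γ, 0 < bsel s ∧ bsel s ≤ γ))

include hβ1 hG16 hβw hlinkLedger

/-! ## §1 Stub 2's N19′ conjunct at the ledger reading, U3-side extras discharged by the two-component road -/

/-- ★★ **`KeyedCoreEdgeHolderD4 β cr (rrOfRecord 𝔯 ksel)` FROM v5's KEY, `β ≤ 1`, K1⁷'s WINDOW, NODE O's LEDGER WORLD, STUB 1's BILL ROWS `hs hL h9 hW`, THE `(0, 0)` COMPONENT AND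
EUCLIDEAN COVARIANCE** [bookkeeping]: dag-n19-w3 g3's (8b) `keyedCoreEdgeHolderD4_rrOfRecord_of_guardedReadingN16_ledgerLinkReading` with `hunif := hunif_of_u3Pinned_of_signs` (FILE 5) and
`hdecT := hdecT_of_u3Pinned_of_stub1Rows_cov` (FILE 6), both read off the `U3PinnedKernels` conjunct of `GuardedReadingN16`.  ONE FACE of `stub_expansion13H` modulo displayed hypotheses —
NOT the stub, NOT K3⁷; N14 ∕ N16 ∕ N19 ∕ N22 NOT discharged.  (The ∀μν road is dag-n19-w3's p618248.) -/
theorem keyedCoreEdgeHolderD4_rrOfRecord_of_guardedReadingN16_ledgerLinkReading_stub1Rows_cov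
    (hs : ∀ (F : T4Family) (θ : Stage13HParams F 2), θ.Provisos₁₃CoPH F 2 → (θ.ZhUnity F 2 ∧ θ.SlotsNondegenerate₁₃ F 2) → θ.Admissible F 2 → (ℓ F θ).Signs)
    (hL : ∀ (F : T4Family) (θ : Stage13HParams F 2), θ.Provisos₁₃CoPH F 2 → (θ.ZhUnity F 2 ∧ θ.SlotsNondegenerate₁₃ F 2) → θ.Admissible F 2 → PolLimitsExistOfRecord₁₃ F 2 θ.toStage13Params)
    (h9 : ∀ (F : T4Family) (θ : Stage13HParams F 2), θ.Provisos₁₃CoPH F 2 → (θ.ZhUnity F 2 ∧ θ.SlotsNondegenerate₁₃ F 2) → θ.Admissible F 2 →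
      WindowedNE9OfRecord₁₃ F 2 θ.toStage13Params (ℓ F θ).κ (ℓ F θ).moduli)
    (hW : ∀ (F : T4Family) (θ : Stage13HParams F 2), θ.Provisos₁₃CoPH F 2 → (θ.ZhUnity F 2 ∧ θ.SlotsNondegenerate₁₃ F 2) → θ.Admissible F 2 →
      WindowedDecayOfRecord₁₃ F 2 θ.toStage13Params 0 1 (ℓ F θ).κ)
    (hW00 : ∀ (F : T4Family) (θ : Stage13HParams F 2), θ.Provisos₁₃CoPH F 2 → (θ.ZhUnity F 2 ∧ θ.SlotsNondegenerate₁₃ F 2) → θ.Admissible F 2 →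
      WindowedDecayOfRecord₁₃ F 2 θ.toStage13Params 0 0 (ℓ F θ).κ)
    (hcov : ∀ (F : T4Family) (θ : Stage13HParams F 2), θ.Provisos₁₃CoPH F 2 → (θ.ZhUnity F 2 ∧ θ.SlotsNondegenerate₁₃ F 2) → θ.Admissible F 2 →
      letI := θ.instVβ₁; letI := θ.instVβ₂; letI := θ.instιβ
      ∀ g' ∈ Window θ.γ, ∀ k : ℕ,
        PermCovariant (kernelA F (mergedTermFamilyMatT F 2 (TβOfRecord₁₃ F 2) (chiβOfRecord₁₃ F 2 θ.toStage13Params) θ.εbg) θ.ρ8 θ.bV g' k)) :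
    KeyedCoreEdgeHolderD4 β cr (rrOfRecord 𝔯 ksel) :=
  keyedCoreEdgeHolderD4_rrOfRecord_of_guardedReadingN16_ledgerLinkReading cr 𝔯 ksel ℓ ℓ₃ g B hβ1 hG16 hβw
    (hunif_of_u3Pinned_of_signs 𝔯 (fun θ => θ.ZhUnity _ 2 ∧ θ.SlotsNondegenerate₁₃ _ 2) ℓ hG16.1.2.2.2 hs) hlinkLedger
    (hdecT_of_u3Pinned_of_stub1Rows_cov 𝔯 (fun θ => θ.ZhUnity _ 2 ∧ θ.SlotsNondegenerate₁₃ _ 2) ℓ hG16.1.2.2.2 hs hL h9 hW hW00 hcov)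

/-! ## §2 `HybridNE7Under` per tuple and the crux's statement, conditionally, by the same road -/

/-- ★★ **`HybridNE7Under` PER GUARDED ADMISSIBLE TUPLE** [bookkeeping]: (8b)'s `hybridNE7Under_of_guardedReadingN16_keyedFaces_ledgerLinkReading` with the two U3-side hypotheses discharged as in §1
(v5's key, stub 1's rates conjunct `hr`, stub 2's other faces `h20 h21 hx`, `β ≤ 1`, `hβw`, `hlinkLedger`, stub 1's rows `hs hL h9 hW` + `hW00` + `hcov`).  NOT K3⁷; no stub proved; N19 NOT discharged. -/
theorem hybridNE7Under_of_guardedReadingN16_keyedFaces_ledgerLinkReading_stub1Rows_cov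
    (hs : ∀ (F : T4Family) (θ : Stage13HParams F 2), θ.Provisos₁₃CoPH F 2 → (θ.ZhUnity F 2 ∧ θ.SlotsNondegenerate₁₃ F 2) → θ.Admissible F 2 → (ℓ F θ).Signs)
    (hL : ∀ (F : T4Family) (θ : Stage13HParams F 2), θ.Provisos₁₃CoPH F 2 → (θ.ZhUnity F 2 ∧ θ.SlotsNondegenerate₁₃ F 2) → θ.Admissible F 2 → PolLimitsExistOfRecord₁₃ F 2 θ.toStage13Params)
    (h9 : ∀ (F : T4Family) (θ : Stage13HParams F 2), θ.Provisos₁₃CoPH F 2 → (θ.ZhUnity F 2 ∧ θ.SlotsNondegenerate₁₃ F 2) → θ.Admissible F 2 →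
      WindowedNE9OfRecord₁₃ F 2 θ.toStage13Params (ℓ F θ).κ (ℓ F θ).moduli)
    (hW : ∀ (F : T4Family) (θ : Stage13HParams F 2), θ.Provisos₁₃CoPH F 2 → (θ.ZhUnity F 2 ∧ θ.SlotsNondegenerate₁₃ F 2) → θ.Admissible F 2 →
      WindowedDecayOfRecord₁₃ F 2 θ.toStage13Params 0 1 (ℓ F θ).κ)
    (hW00 : ∀ (F : T4Family) (θ : Stage13HParams F 2), θ.Provisos₁₃CoPH F 2 → (θ.ZhUnity F 2 ∧ θ.SlotsNondegenerate₁₃ F 2) → θ.Admissible F 2 →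
      WindowedDecayOfRecord₁₃ F 2 θ.toStage13Params 0 0 (ℓ F θ).κ)
    (hcov : ∀ (F : T4Family) (θ : Stage13HParams F 2), θ.Provisos₁₃CoPH F 2 → (θ.ZhUnity F 2 ∧ θ.SlotsNondegenerate₁₃ F 2) → θ.Admissible F 2 →
      letI := θ.instVβ₁; letI := θ.instVβ₂; letI := θ.instιβ
      ∀ g' ∈ Window θ.γ, ∀ k : ℕ,
        PermCovariant (kernelA F (mergedTermFamilyMatT F 2 (TβOfRecord₁₃ F 2) (chiβOfRecord₁₃ F 2 θ.toStage13Params) θ.εbg) θ.ρ8 θ.bV g' k))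
    (hr : KeyedRatesHolderD4 β (rrOfRecord 𝔯 ksel))
    (h20 : KeyedRelWeight cr) (h21 : KeyedShellWeight cr) (hx : KeyedExtraction cr)
    (F : T4Family) (θ : Stage13HParams F 2) (hP : θ.Provisos₁₃CoPH F 2) (hGd : θ.ZhUnity F 2 ∧ θ.SlotsNondegenerate₁₃ F 2) (hθ : θ.Admissible F 2) :
    HybridNE7Under (datumOfRecord₁₃CoPH F 2 θ hP) (DagBinding.EndpointExistence (datumOfRecord₁₃CoPH F 2 θ hP).C.toB12) :=
  hybridNE7Under_of_guardedReadingN16_keyedFaces_ledgerLinkReading cr 𝔯 ksel ℓ ℓ₃ g B hβ1 hG16 hβw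
    (hunif_of_u3Pinned_of_signs 𝔯 (fun θ => θ.ZhUnity _ 2 ∧ θ.SlotsNondegenerate₁₃ _ 2) ℓ hG16.1.2.2.2 hs) hlinkLedger
    (hdecT_of_u3Pinned_of_stub1Rows_cov 𝔯 (fun θ => θ.ZhUnity _ 2 ∧ θ.SlotsNondegenerate₁₃ _ 2) ℓ hG16.1.2.2.2 hs hL h9 hW hW00 hcov) hr h20 h21 hx F θ hP hGd hθ

/-- ★★ **K3⁷'s STATEMENT BY NAME, CONDITIONALLY, BY THE TWO-COMPONENT ROAD** [bookkeeping]: `…Theses.BalabanUVNodes.SpineGivenEndpointR13SepCoPH` from the displayed HYPOTHESES — v5's key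
`GuardedReadingN16`, stub 1's rates conjunct, stub 2's N20 ∕ N21 ∕ N27x faces at `cr`, `β ≤ 1`, K1⁷'s window, NODE O's ledger world `hlinkLedger`, stub 1's U3 letter rows `hs hL h9 hW`, the `(0, 0)`
component `hW00` and the covariance row `hcov` ((8b)'s third theorem, same substitution).  A CONDITIONAL reading of the crux; NOT a proof of K3⁷ (OPEN, unclaimed); no stub proved; nothing of
Bałaban asserted; counts unmoved. -/
theorem spineGivenEndpointR13SepCoPH_of_guardedReadingN16_keyedFaces_ledgerLinkReading_stub1Rows_cov
    (hs : ∀ (F : T4Family) (θ : Stage13HParams F 2), θ.Provisos₁₃CoPH F 2 → (θ.ZhUnity F 2 ∧ θ.SlotsNondegenerate₁₃ F 2) → θ.Admissible F 2 → (ℓ F θ).Signs)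
    (hL : ∀ (F : T4Family) (θ : Stage13HParams F 2), θ.Provisos₁₃CoPH F 2 → (θ.ZhUnity F 2 ∧ θ.SlotsNondegenerate₁₃ F 2) → θ.Admissible F 2 → PolLimitsExistOfRecord₁₃ F 2 θ.toStage13Params)
    (h9 : ∀ (F : T4Family) (θ : Stage13HParams F 2), θ.Provisos₁₃CoPH F 2 → (θ.ZhUnity F 2 ∧ θ.SlotsNondegenerate₁₃ F 2) → θ.Admissible F 2 →
      WindowedNE9OfRecord₁₃ F 2 θ.toStage13Params (ℓ F θ).κ (ℓ F θ).moduli)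
    (hW : ∀ (F : T4Family) (θ : Stage13HParams F 2), θ.Provisos₁₃CoPH F 2 → (θ.ZhUnity F 2 ∧ θ.SlotsNondegenerate₁₃ F 2) → θ.Admissible F 2 →
      WindowedDecayOfRecord₁₃ F 2 θ.toStage13Params 0 1 (ℓ F θ).κ)
    (hW00 : ∀ (F : T4Family) (θ : Stage13HParams F 2), θ.Provisos₁₃CoPH F 2 → (θ.ZhUnity F 2 ∧ θ.SlotsNondegenerate₁₃ F 2) → θ.Admissible F 2 →
      WindowedDecayOfRecord₁₃ F 2 θ.toStage13Params 0 0 (ℓ F θ).κ)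
    (hcov : ∀ (F : T4Family) (θ : Stage13HParams F 2), θ.Provisos₁₃CoPH F 2 → (θ.ZhUnity F 2 ∧ θ.SlotsNondegenerate₁₃ F 2) → θ.Admissible F 2 →
      letI := θ.instVβ₁; letI := θ.instVβ₂; letI := θ.instιβ
      ∀ g' ∈ Window θ.γ, ∀ k : ℕ,
        PermCovariant (kernelA F (mergedTermFamilyMatT F 2 (TβOfRecord₁₃ F 2) (chiβOfRecord₁₃ F 2 θ.toStage13Params) θ.εbg) θ.ρ8 θ.bV g' k))
    (hr : KeyedRatesHolderD4 β (rrOfRecord 𝔯 ksel))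
    (h20 : KeyedRelWeight cr) (h21 : KeyedShellWeight cr) (hx : KeyedExtraction cr) :
    Summit.QuantumFields.YangMills.Theses.BalabanUVNodes.SpineGivenEndpointR13SepCoPH :=
  spineGivenEndpointR13SepCoPH_of_guardedReadingN16_keyedFaces_ledgerLinkReading cr 𝔯 ksel ℓ ℓ₃ g B hβ1 hG16 hβw
    (hunif_of_u3Pinned_of_signs 𝔯 (fun θ => θ.ZhUnity _ 2 ∧ θ.SlotsNondegenerate₁₃ _ 2) ℓ hG16.1.2.2.2 hs) hlinkLedger
    (hdecT_of_u3Pinned_of_stub1Rows_cov 𝔯 (fun θ => θ.ZhUnity _ 2 ∧ θ.SlotsNondegenerate₁₃ _ 2) ℓ hG16.1.2.2.2 hs hL h9 hW hW00 hcov) hr h20 h21 hx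

end ByName

end Summit.QuantumFields.YangMills.BalabanUVNodes.N19KeyedCoreEdgeHolderD4LedgerK3V5Stub1Rows

end
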